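import Literature.NumberTheory.Automorphic.CMXiTorusCharSplitTorusDecay
import Literature.NumberTheory.Automorphic.CMLocalRingModulusContinuous
import HarnessLib

/-!
# The first coordinate `χ_ξ,1 = η̃₁ · μ · ‖·‖^{1/2}` of Keys' case-(2) exponent at a non-split place: continuous, and
# `‖χ_ξ,1(t)‖ < 1` on the `σ`-fixed units with `‖t‖ < 1` (`A⁻ ∖ A(𝒪)`)
(Rogawski, *Automorphic Representations of Unitary Groups in Three Variables* (1990), §12.1 p. 172, §12.2 (2) pp. 173–174;
Casselman, *Introduction to the theory of admissible representations of p-adic reductive groups* (1995), Prop. 7.1.3 hypothesis,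
§1.4.)

Topic `NumberTheory/Automorphic`; namespace `Literature.NumberTheory.Automorphic.UnitaryGroup`. THEOREMS ONLY (no definition, no
named fact, no instance, no notation, no `sorry`). Cell `hodgecm-mathlib`, F0∕P3 «U3-mult», crux H413 (`stmt-HodgeConjecture-24833`),
books row NF1 `Rogawski1990.KeysCaseTwo`: the analytic glue `stub_xi_char : XiCharFacts L` (PAYABLE-S) of the T3 «KeysCaseTwo» pay-down
draft `F0/P3/Lines-draft/T3a_KeysCaseTwoPaydownByName.lean` (typ-T3a (g0)), with the def's body VERBATIM as the statement of
`cmXiChar_continuous_and_norm_lt_one`, so that the registry folds `stub_xi_char L := cmXiChar_continuous_and_norm_lt_one L`.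

For the case-(2) data at a non-split `v` of `L⁺` in the CM field `L` — a character `μ` of `(Π_{w∣v} L_w)^×` extending `ω_{E/F}`
(★ `IsQuadraticCharExtension`), a character `η₁` of the norm-one units, `η̃₁ = η₁ ∘ (a ↦ a/ā)` (★ `quotConj`), `‖·‖^{1/2}` (★
`halfModulusChar`) — the first coordinate `χ_ξ,1 = η̃₁ · μ · ‖·‖^{1/2}` of Rogawski's exponent `χ_ξ` satisfies:
* (i) it is CONTINUOUS when `μ` and `η₁` are — ★ `continuous_cmXiTorusChar_fst` (`CMLocalRingModulusContinuous`) BY NAME;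
* (ii) **`norm_cmXiChar_fst_lt_one`** — it DECAYS on `A⁻ ∖ A(𝒪)`: for a `σ`-fixed unit `t` with `‖t‖ < 1`, `η̃₁(t) = 1` (★
  `quotConj_eq_one_of_map_eq`), `‖μ(t)‖ = 1` (`μ(t)² = μ(t t̄) = 1`, ★ `norm_apply_eq_one_of_isQuadraticCharExtension`) and
  `‖t‖^{1/2} < 1` (★ `coe_halfModulusChar_apply`), so `‖χ_ξ,1(t)‖ = ‖t‖^{1/2} < 1` — Casselman's hypothesis «`|σ(a)| < 1` for
  `a ∈ A⁻ ∖ A_∅(𝒪)A_Δ`» of Prop. 7.1.3 for `χ_ξ`; the UNIT-level form of ★ `norm_cmXiTorusChar_lt_one` (which reads it at the torus element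
  `d(a, 1, a⁻¹)`).

HC_CM is proved only modulo the 7 printed citations until rung 0 closes.

## References

* J. D. Rogawski, *Automorphic Representations of Unitary Groups in Three Variables*, Ann. of Math. Stud. 123 (1990), §12.1 p. 172,
  §12.2 (2) pp. 173–174 [Rogawski1990].
* W. Casselman, *Introduction to the theory of admissible representations of p-adic reductive groups* (1995), §1.4, Prop. 7.1.3
  [Casselman1995].
-/

set_option autoImplicit false

noncomputable section

open NumberField IsDedekindDomain MeasureTheory
open scoped NNReal

namespace Literature.NumberTheory.Automorphic.UnitaryGroup

section CM

variable (L : Type) [Field L] [NumberField L] [IsCMField L] (v : HeightOneSpectrum (𝓞 ↥(maximalRealSubfield L)))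

/-- **`‖χ_ξ,1(t)‖ < 1` on `A⁻ ∖ A(𝒪)`** (unit-level form): for the case-(2) data `(μ, η₁)` at `v` with `μ|_{F^×} = ω_{E/F}`
(★ `IsQuadraticCharExtension`) and a `σ`-fixed unit `t` of `Π_{w∣v} L_w` with `‖t‖ < 1`:
`‖(η̃₁ · μ · ‖·‖^{1/2})(t)‖ = ‖t‖^{1/2} < 1` (`η̃₁(t) = 1`, `‖μ(t)‖ = 1`). [cite: Casselman1995, Prop. 7.1.3, §1.4]
[cite: Rogawski1990, §12.2 (2) p. 174] -/
theorem norm_cmXiChar_fst_lt_one (μ : (LocalRing L v)ˣ →* ℂˣ)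
    (η₁ : ↥(normOneUnits (conjLocal L (IsCMField.complexConj L) v)) →* ℂˣ)
    (hμ : IsQuadraticCharExtension (conjLocal L (IsCMField.complexConj L) v) μ)
    (t : (LocalRing L v)ˣ) (hfix : conjLocal L (IsCMField.complexConj L) v (t : LocalRing L v) = t)
    (hm : unitModulusChar (LocalRing L v) t < 1) :
    ‖(((η₁.comp (quotConj (conjLocal L (IsCMField.complexConj L) v) (conjLocal_conjLocal_cm L v)) * μ *
        halfModulusChar (LocalRing L v)) t : ℂˣ) : ℂ)‖ < 1 := by
  have hq := quotConj_eq_one_of_map_eq (conjLocal L (IsCMField.complexConj L) v) (conjLocal_conjLocal_cm L v) _ hfix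
  have hμn := norm_apply_eq_one_of_isQuadraticCharExtension (conjLocal L (IsCMField.complexConj L) v) μ hμ _ hfix
  rw [MonoidHom.mul_apply, MonoidHom.mul_apply, MonoidHom.comp_apply, hq, map_one, one_mul, Units.val_mul, norm_mul,
    hμn, one_mul, coe_halfModulusChar_apply, Complex.norm_real, Real.norm_eq_abs, NNReal.abs_eq, NNReal.coe_lt_one]
  have hlt := NNReal.sqrt_lt_sqrt.2 hm
  rwa [NNReal.sqrt_one] at hlt

/-- **THE ANALYTIC FACTS ABOUT `χ_ξ,1 = η̃₁ · μ · ‖·‖^{1/2}` (the body of `XiCharFacts L` VERBATIM)**: for the case-(2) data at every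
non-split `v`, (i) `χ_ξ,1` is CONTINUOUS (★ `continuous_cmXiTorusChar_fst`), and (ii) `‖χ_ξ,1(t)‖ < 1` for every `σ`-fixed unit `t`
with `‖t‖ < 1` (`norm_cmXiChar_fst_lt_one`) — the hypothesis of Casselman's Prop. 7.1.3 at Rogawski's `χ_ξ`.
[cite: Rogawski1990, §12.2 (2) p. 174] [cite: Casselman1995, Prop. 7.1.3, §1.4] -/
theorem cmXiChar_continuous_and_norm_lt_one :
    ∀ (v : HeightOneSpectrum (𝓞 ↥(maximalRealSubfield L))),
      (∀ w : PlacesOver L v, IsCMField.complexConj L • w.1 = w.1) →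
      ∀ (μ : (LocalRing L v)ˣ →* ℂˣ) (η₁ : ↥(normOneUnits (conjLocal L (IsCMField.complexConj L) v)) →* ℂˣ),
        IsQuadraticCharExtension (conjLocal L (IsCMField.complexConj L) v) μ →
        Continuous (fun x => ((μ x : ℂˣ) : ℂ)) → Continuous (fun x => ((η₁ x : ℂˣ) : ℂ)) →
      Continuous (fun x => (((η₁.comp (quotConj (conjLocal L (IsCMField.complexConj L) v) (conjLocal_conjLocal_cm L v)) * μ *
          halfModulusChar (LocalRing L v)) x : ℂˣ) : ℂ)) ∧
      ∀ t : (LocalRing L v)ˣ, conjLocal L (IsCMField.complexConj L) v (t : LocalRing L v) = t →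
        unitModulusChar (LocalRing L v) t < 1 →
        ‖(((η₁.comp (quotConj (conjLocal L (IsCMField.complexConj L) v) (conjLocal_conjLocal_cm L v)) * μ *
            halfModulusChar (LocalRing L v)) t : ℂˣ) : ℂ)‖ < 1 :=
  fun v _ μ η₁ hμ hμc h1c =>
    ⟨continuous_cmXiTorusChar_fst L v μ η₁ hμc h1c, fun t hfix hm => norm_cmXiChar_fst_lt_one L v μ η₁ hμ t hfix hm⟩

end CM

end Literature.NumberTheory.Automorphic.UnitaryGroup
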